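import Summits.QuantumFields.YangMills.Theorems.BalabanUVNodesN15PerCubeGreenFineKnit
import Summits.QuantumFields.YangMills.Theorems.BalabanUVNodesN15TwoSpacingGluingCurvedKnitReg335Box
import HarnessLib

/-!
# FINE-GRID TWIN n15-c∕263′ of n15-c∕263 at spacing `L^{−r}L^{−k}`: the SAME statements and proofs on the fine site carrier `ScX' = Tor (fine (L^r·L^k) (cvM))` of n15-c∕260′
# (primed objects `scShift' scChi' scPsi' scQQ' scCube' scGlued' scP' scNV' …`, extra argument `r ≥ 1`, mass `a_K(a₀,L,r+k)·(L^rL^k)^{d+1}`, flat rows Ξ-4 r5∕r6∕r8); prepared for the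
# two-grid η-defect (PC-E). Textual twin of the coarse file (token priming + `L^k ↦ L^r·L^k`); carrier-generic lemmas are IMPORTED from the coarse files, carrier-specific ones are primed.
#
# N15 = NE2, road (c) — PROGRAMME (PC), FILE D: THE SCALAR COVARIANT GREEN's FUNCTION KNIT FOR A BACKGROUND IN BAŁABAN's PRINTED CLASS (3.35) PER CUBE —
# FILE C's displayed rows `hu`, `hCloc`, `hAloc` PRODUCED from ONE `Reg335Cube` datum per box (lit-balaban r06's class = [B9] (3.35) on a cube, NO global gauge) by
# dag-n15-w2's `uN_exists_gauge_cutCoefLetters_of_reg335Cube`, the box = the one-block neighbourhood of the cut box (n15-c∕127 §2 at the bond `(x, 0)`) (dag-n15-c g26, n15-c∕263′)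

Cell `pub-ymgap`, seat `pub-ymgap-dag-n15-c` (generation g26; R134 (a), s1; HUMAN RULING D-0062; chair R424 venue).  `bears_on: R4∕N15 · K3⁸ SpineGivenEndpointR13SepCoPHV
(stmt-QuantumFields-27366)`; filed `--kind proof --supports stmt-QuantumFields-27366 --as helper` — COUNT-NEUTRAL.  Two theorems; 0 `def`, 0 `sorry`.  Imports BY NAME n15-c∕262′
`…PerCubeGreenFineKnit` (`uN_scGlued'_spec`), n15-c∕127 `…TwoSpacingGluingCurvedKnitReg335Box` (`chiCube_cut_ne_zero_nbhd`: the cut box and its one-step neighbours lie in the box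
`c(2w+1,k) + [0,6w+3)`, any spacing; through it dag-n15-w2 g6 `…CurvedLocalCoefLettersOfReg335UN` `uN_exists_gauge_cutCoefLetters_of_reg335Cube`, generic in the carrier, and
lit-balaban r06 `B9Eq335RegularityClasses.Reg335Cube`).  Nothing in the tree is modified.

WHY ∕ WHAT.  [Balaban1985BackgroundPropagators] p.396 (3.35): *«for an arbitrary cube □ of the class … there exists a gauge transformation u on □ such that U^u = e^{iηA} and
|A| < O(1)Mα₀(Lʲη)⁻¹, |∇^ηA| < O(1)Mα₀(Lʲη)⁻² on □̃»*; Cor. 3.6 p.408 + Thm 3.7 p.409: the local operators in the local gauges feed the random walk (3.90) for `G′`.  FILE C is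
that random walk on the scalar carrier with the per-cube gauges `u_k` and their (3.35) letters DISPLAYED (`hu hCloc hAloc`); THIS FILE produces them from the printed class, read on
SITES: ★★★ `uN_scGlued'_spec_of_reg335Cube` (the class on sets `Q_k` containing the cut box and its `±e_μ` neighbours) and ★★★ `uN_scGlued'_spec_of_reg335Box` (the canonical boxes
`Q_k = {x | B(x) ∈ c(2w+1,k) + [0,6w+3)}`, interior hypothesis discharged by n15-c∕127 §2 at `(x, 0)`).  Still displayed (the summand's rows, FILE C's `hP hNVcut hfarN`): the sequel
instantiates `P := a·Q′_Tᵀ Q′_T` (so that `Δ_{R_U} + P = Δ′_a(U)` and the glued operator is `G′(U)`).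

HONEST FRAMING ∕ LIMITS.  Composition of LANDED theorems on MODEL carriers (doubled-cube torus cover, one scale, unit weights, torus local propagators; `U(m)`-valued site bond fields
in trace-form coordinates; crude constants); the SHAPE of [B9] Cor. 3.6 ∕ Thm 3.7 at MODEL level — NOT the printed theorems; nothing of [B5]∕[B6]∕[B9] asserted.  NE2⁺ NOT PRINTED, NOT
proved; N15 of record untouched (DISCHARGED AS CONSUMED, p687738); K3⁸ OPEN; counts of record UNMOVED (typed 28∕28 · discharged 8∕27); one finite 𝕋⁴ at fixed ε per index — NOT
infinite volume, NOT OS on ℝ⁴, NOT a mass gap, NOT Clay.  Restate-immune (no Theses import).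
-/

noncomputable section

open scoped BigOperators Matrix Matrix.Norms.L2Operator

namespace Summit.QuantumFields.YangMills.BalabanUVNodes.N15.Gluing

open Real
open Literature.MathematicalPhysics.QuantumFieldTheory.Balaban1983to89
open Literature.MathematicalPhysics.QuantumFieldTheory.Balaban1983to89.B5Prop11Plancherel (Tor fine unitVec)
open Literature.MathematicalPhysics.QuantumFieldTheory.Balaban1983to89.B11SectG (BlockNorm HasMaj)
open Literature.MathematicalPhysics.QuantumFieldTheory.Balaban1983to89.B6Prop26Gluing (mulOp)
open Literature.MathematicalPhysics.QuantumFieldTheory.Balaban1983to89.B6UnitTorusCarrier (unitTorusGeo)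
open Literature.MathematicalPhysics.QuantumFieldTheory.Balaban1983to89.B9Eq335RegularityClasses (Reg335Cube)
open Literature.MathematicalPhysics.QuantumFieldTheory.King1986 (aK)
open Literature.MathematicalPhysics.QuantumFieldTheory.King1986.Torus (blockOf)
open Literature.Barriers.QuantumFields (traceForm)
open Summit.QuantumFields.YangMills.BalabanUVNodes.N15.BackgroundLayer (covLapM tCoefA tCoefC)
open Summit.QuantumFields.YangMills.BalabanUVNodes.N15.VectorPiece (bshiftEquiv bshiftEquiv_apply)
open Summit.QuantumFields.YangMills.BalabanUVNodes.N15.MatrixSpecies (mmulOp coordMat basisConst liftEquiv)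
open Summit.QuantumFields.YangMills.BalabanUVNodes.N15.TwoGrid (chiCube cubeBlocks)
open Summit.QuantumFields.YangMills.BalabanUVNodes.N15.CurvedSpecies (gaugePair uN_exists_gauge_cutCoefLetters_of_reg335Cube)

variable {d : ℕ}

section Reg335

variable {L : ℕ} [NeZero L]

/-- the site form of n15-c∕127 §2: a site under the cut `χ_k` and its `±e_μ` neighbours lie in the box `Q_k = {x | B(x) ∈ c(2w+1,k) + [0,6w+3)}` (read at the bond `(x, 0)`). [folklore] -/
theorem scChi'_ne_zero_nbhd (hL : Odd L ∧ 1 < L) (hL7 : 7 ≤ L) (mv kk r : ℕ) (k : Fin (d + 1) → ZMod (2 * L)) (x : ScX' d L mv kk r hL) (hx : scChi' d L mv kk r hL k x ≠ 0) :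
    x ∈ {x : ScX' d L mv kk r hL | blockOf (L ^ r * L ^ kk) (cvM d L mv kk hL) x ∈ cubeBlocks (cvM d L mv kk hL) (coverCorner (cvM d L mv kk hL) (L ^ mv) L (2 * L ^ mv + 1) k) (6 * L ^ mv + 3)} ∧
      (∀ μ, scShift' d L mv kk r hL μ x ∈ {x : ScX' d L mv kk r hL | blockOf (L ^ r * L ^ kk) (cvM d L mv kk hL) x ∈ cubeBlocks (cvM d L mv kk hL) (coverCorner (cvM d L mv kk hL) (L ^ mv) L (2 * L ^ mv + 1) k) (6 * L ^ mv + 3)}) ∧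
      (∀ μ, (scShift' d L mv kk r hL μ).symm x ∈ {x : ScX' d L mv kk r hL | blockOf (L ^ r * L ^ kk) (cvM d L mv kk hL) x ∈ cubeBlocks (cvM d L mv kk hL) (coverCorner (cvM d L mv kk hL) (L ^ mv) L (2 * L ^ mv + 1) k) (6 * L ^ mv + 3)}) := by
  obtain ⟨h0, h1, h2⟩ := chiCube_cut_ne_zero_nbhd (d := d) hL hL7 mv kk (L ^ r * L ^ kk) k (x, 0) hx
  refine ⟨h0, fun μ => h1 μ, fun μ => ?_⟩
  have h := h2 μ
  simp only [Set.mem_setOf_eq, VectorPiece.bshiftEquiv_symm_apply] at h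
  simpa only [Set.mem_setOf_eq, Equiv.addRight_symm, Equiv.coe_addRight, ← sub_eq_add_neg] using h

/-- ★★★ **THE SCALAR COVARIANT GREEN's FUNCTION KNIT FOR A BACKGROUND IN BAŁABAN's CLASS (3.35) PER CUBE** (FILE C `uN_scGlued'_spec` + dag-n15-w2 `uN_exists_gauge_cutCoefLetters_of_reg335Cube`
on SITES): for odd `L ≥ 7`, `a₀ > 0`, a colour index `ι` there are `δ, w₀, R₀, θ₀, B > 0` (FILE C's) such that on every doubled torus `2L·L^m` of the cover (`k ≥ 1`, `L^m ≥ w₀`), at King's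
mass `a_K(a₀,L,r+k)·(L^rL^k)^{d+1}`, for trace-form coordinates `e` of `𝔲(m)`, every `U(m)`-valued SITE bond field `U` which on sets `Q_k` containing each cut box and its `±e_μ` neighbours is in
`Reg335Cube scShift' U L^{−k} Q_k ξ C`, and every `r_V` dominating the two displayed explicit bounds with `r_V(1+|J⊕J|) + R_N ≤ R₀`, `θ_F ≤ θ₀`: THERE ARE per-cube site gauges `w_k`,
UNITARY EVERYWHERE, such that for every summand `P` with the conjugation law `M_{W_k}PM_{W_kᵀ} = a·Q′ᵀQ′ ⊗ 1 − N_V k` in these gauges and every `N_V` with the cut letter `R_N` and far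
letter `θ_F` at rate `δ`, `scGlued' … w U P N_V ≤ B·e^{−(δ∕16)|y−y′|_T}` blockwise and it is the two-sided inverse of `Δ_{R_U} + P`.  MODEL carriers; the SHAPE of [B9] Cor. 3.6 ∕ Thm 3.7.
[cite: Balaban1985BackgroundPropagators, (3.34)–(3.35) p.396, Cor. 3.6 p.408, Thm 3.7 (3.90) p.409, (3.62)–(3.65) pp.402–403 (shape ∕ mechanism); Balaban1984PropagatorsII, (2.91)–(2.93) p.239] -/
theorem uN_scGlued'_spec_of_reg335Cube (hL : Odd L ∧ 1 < L) (hL7 : 7 ≤ L) {a₀ : ℝ} (ha₀ : 0 < a₀) (ι : Type) [Fintype ι] [DecidableEq ι] :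
    ∃ δ w₀ R₀ θ₀ B : ℝ, 0 < δ ∧ 0 < R₀ ∧ 0 < θ₀ ∧ 0 < B ∧
      ∀ (mv kk r : ℕ), 1 ≤ kk → 1 ≤ r → w₀ ≤ ((L ^ mv : ℕ) : ℝ) →
      ∀ {mm : Type} [Fintype mm] [DecidableEq mm] [Nonempty mm] (e : Matrix mm mm ℂ ≃L[ℝ] (ι → ℝ)), (∀ A B : Matrix mm mm ℂ, traceForm A B = e A ⬝ᵥ e B) →
      ∀ (U : Fin (d + 1) → ScX' d L mv kk r hL → (Matrix mm mm ℂ)ˣ), (∀ μ x, (U μ x : Matrix mm mm ℂ) ∈ Matrix.unitaryGroup mm ℂ) →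
      ∀ (Q : (Fin (d + 1) → ZMod (2 * L)) → Set (ScX' d L mv kk r hL)) (ξ C : ℝ), 0 < ξ → 0 ≤ C →
        (∀ k, Reg335Cube (scShift' d L mv kk r hL) U ((((L ^ r * L ^ kk : ℕ) : ℝ))⁻¹) (Q k) ξ C) →
        (∀ k x, scChi' d L mv kk r hL k x ≠ 0 → x ∈ Q k ∧ (∀ μ, scShift' d L mv kk r hL μ x ∈ Q k) ∧ (∀ μ, (scShift' d L mv kk r hL μ).symm x ∈ Q k)) →
      ∀ (rV RN θF : ℝ), 0 ≤ rV → 0 ≤ RN → 0 ≤ θF →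
        Fintype.card ι * (@basisConst ι _ (Matrix mm mm ℂ) Matrix.frobeniusNormedAddCommGroup Matrix.frobeniusNormedSpace e * (2 * Real.sqrt (Fintype.card mm)) * (Real.sqrt (Fintype.card mm) * ((C / ξ) * Real.exp (((((L ^ r * L ^ kk : ℕ) : ℝ))⁻¹) * (C / ξ))))) ≤ rV →
        Fintype.card ι * (Fintype.card (Fin (d + 1)) * (Fintype.card ι * (@basisConst ι _ (Matrix mm mm ℂ) Matrix.frobeniusNormedAddCommGroup Matrix.frobeniusNormedSpace e * (2 * Real.sqrt (Fintype.card mm)) * (Real.sqrt (Fintype.card mm) * ((C / ξ) * Real.exp (((((L ^ r * L ^ kk : ℕ) : ℝ))⁻¹) * (C / ξ))))) ^ 2 + @basisConst ι _ (Matrix mm mm ℂ) Matrix.frobeniusNormedAddCommGroup Matrix.frobeniusNormedSpace e * (2 * Real.sqrt (Fintype.card mm)) * (Real.sqrt (Fintype.card mm) * ((C / ξ ^ 2) * Real.exp (((((L ^ r * L ^ kk : ℕ) : ℝ))⁻¹) * (C / ξ)))))) ≤ rV →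
        rV * (1 + Fintype.card (Fin (d + 1) ⊕ Fin (d + 1))) + RN ≤ R₀ → θF ≤ θ₀ →
      ∃ w : (Fin (d + 1) → ZMod (2 * L)) → ScX' d L mv kk r hL → Matrix mm mm ℂ, (∀ k x, (w k x)ᴴ * w k x = 1) ∧
        ∀ (P : (ScX' d L mv kk r hL × ι → ℝ) →ₗ[ℝ] (ScX' d L mv kk r hL × ι → ℝ)) (NV : (Fin (d + 1) → ZMod (2 * L)) → (ScX' d L mv kk r hL × ι → ℝ) →ₗ[ℝ] (ScX' d L mv kk r hL × ι → ℝ)),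
        (∀ k, mmulOp (fun x => coordMat e (ContinuousLinearMap.mulLeftRight ℝ (Matrix mm mm ℂ) (w k x) (w k x)ᴴ)) ∘ₗ P ∘ₗ mmulOp (fun x => (coordMat e (ContinuousLinearMap.mulLeftRight ℝ (Matrix mm mm ℂ) (w k x) (w k x)ᴴ))ᵀ) = (scQQ' d L mv kk r hL (aK a₀ (L : ℝ) (r + kk) * (((L ^ r * L ^ kk : ℕ) : ℝ)) ^ (d + 1)) ι) - NV k) →
        (∀ k, HasMaj (ScNorm' d L mv kk r hL ι) (ScNorm' d L mv kk r hL ι) (mulOp (fun p : ScX' d L mv kk r hL × ι => scPsi' d L mv kk r hL k p.1) ∘ₗ NV k ∘ₗ mulOp (fun p : ScX' d L mv kk r hL × ι => scChi' d L mv kk r hL k p.1)) (fun y y' => RN * Real.exp (-(δ * (unitTorusGeo L kk (cvM d L mv kk hL)).dist y y')))) →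
        (∀ k, HasMaj (ScNorm' d L mv kk r hL ι) (ScNorm' d L mv kk r hL ι) ((LinearMap.id - mulOp (fun p : ScX' d L mv kk r hL × ι => scPsi' d L mv kk r hL k p.1)) ∘ₗ NV k ∘ₗ mulOp (fun p : ScX' d L mv kk r hL × ι => scChi' d L mv kk r hL k p.1)) (fun y y' => θF * Real.exp (-(δ * (unitTorusGeo L kk (cvM d L mv kk hL)).dist y y')))) →
        HasMaj (ScNorm' d L mv kk r hL ι) (ScNorm' d L mv kk r hL ι) (scGlued' d L mv kk r hL (aK a₀ (L : ℝ) (r + kk) * (((L ^ r * L ^ kk : ℕ) : ℝ)) ^ (d + 1)) ((((L ^ r * L ^ kk : ℕ) : ℝ))⁻¹) ι e w (fun μ x => (U μ x : Matrix mm mm ℂ)) P NV)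
          (fun y y' => B * Real.exp (-(δ / 16 * (unitTorusGeo L kk (cvM d L mv kk hL)).dist y y'))) ∧
        (scGlued' d L mv kk r hL (aK a₀ (L : ℝ) (r + kk) * (((L ^ r * L ^ kk : ℕ) : ℝ)) ^ (d + 1)) ((((L ^ r * L ^ kk : ℕ) : ℝ))⁻¹) ι e w (fun μ x => (U μ x : Matrix mm mm ℂ)) P NV ∘ₗ
            (covLapM (scShift' d L mv kk r hL) ((((L ^ r * L ^ kk : ℕ) : ℝ))⁻¹) (gaugePair (scShift' d L mv kk r hL) (fun μ x => coordMat e (ContinuousLinearMap.mulLeftRight ℝ (Matrix mm mm ℂ) (U μ x : Matrix mm mm ℂ) (U μ x : Matrix mm mm ℂ)ᴴ))) + P) = LinearMap.id ∧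
          (covLapM (scShift' d L mv kk r hL) ((((L ^ r * L ^ kk : ℕ) : ℝ))⁻¹) (gaugePair (scShift' d L mv kk r hL) (fun μ x => coordMat e (ContinuousLinearMap.mulLeftRight ℝ (Matrix mm mm ℂ) (U μ x : Matrix mm mm ℂ) (U μ x : Matrix mm mm ℂ)ᴴ))) + P) ∘ₗ
            scGlued' d L mv kk r hL (aK a₀ (L : ℝ) (r + kk) * (((L ^ r * L ^ kk : ℕ) : ℝ)) ^ (d + 1)) ((((L ^ r * L ^ kk : ℕ) : ℝ))⁻¹) ι e w (fun μ x => (U μ x : Matrix mm mm ℂ)) P NV = LinearMap.id) := by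
  obtain ⟨δ, w₀, R₀, θ₀, B, hδ, hR₀, hθ₀, hB, H⟩ := uN_scGlued'_spec (d := d) hL hL7 ha₀ ι
  refine ⟨δ, w₀, R₀, θ₀, B, hδ, hR₀, hθ₀, hB, fun mv kk r hk hr hw₀ => ?_⟩
  intro mm _ _ _ e he U hU Q ξ C hξ hC h335 hQ rV RN θF hrV hRN hθF hrA hrC hRle hθle
  have hη : (0 : ℝ) < (((L ^ r * L ^ kk : ℕ) : ℝ))⁻¹ := inv_pos.mpr (Nat.cast_pos.mpr (Nat.mul_pos (pow_pos (Nat.pos_of_ne_zero (NeZero.ne L)) r) (pow_pos (Nat.pos_of_ne_zero (NeZero.ne L)) kk)))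
  choose w hwu hwC hwA using fun k => uN_exists_gauge_cutCoefLetters_of_reg335Cube e (scShift' d L mv kk r hL) U he hη hU hξ hC (h335 k) (hQ k) hrA hrC
  refine ⟨w, fun k x => hwu k x, fun P NV hP hNVcut hfarN => ?_⟩
  exact H mv kk r hk hr hw₀ e he w (fun k x => hwu k x) (fun μ x => (U μ x : Matrix mm mm ℂ)) P NV rV RN θF hrV hRN hθF hRle hθle hP (fun k => hwC k) (fun k => hwA k) hNVcut hfarN

/-- ★★★ **THE SAME ON THE CANONICAL {x : ScX' d L mv kk r hL | blockOf (L ^ r * L ^ kk) (cvM d L mv kk hL) x ∈ cubeBlocks (cvM d L mv kk hL) (coverCorner (cvM d L mv kk hL) (L ^ mv) L (2 * L ^ mv + 1) k) (6 * L ^ mv + 3)}ES `Q_k = {x | B(x) ∈ c(2w+1,k) + [0,6w+3)}`** — the class hypothesis read on the one-block neighbourhood of each cut box, the interior hypothesis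
discharged by `scChi'_ne_zero_nbhd` (n15-c∕127 §2 at `(x, 0)`).  MODEL carriers; the SHAPE of [B9] Cor. 3.6 ∕ Thm 3.7 («(3.35) on □̃»), not the printed theorems.
[cite: Balaban1985BackgroundPropagators, (3.34)–(3.35) p.396, Cor. 3.6 p.408, Thm 3.7 (3.90) p.409; Balaban1984PropagatorsII, (2.91)–(2.93) p.239] -/
theorem uN_scGlued'_spec_of_reg335Box (hL : Odd L ∧ 1 < L) (hL7 : 7 ≤ L) {a₀ : ℝ} (ha₀ : 0 < a₀) (ι : Type) [Fintype ι] [DecidableEq ι] :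
    ∃ δ w₀ R₀ θ₀ B : ℝ, 0 < δ ∧ 0 < R₀ ∧ 0 < θ₀ ∧ 0 < B ∧
      ∀ (mv kk r : ℕ), 1 ≤ kk → 1 ≤ r → w₀ ≤ ((L ^ mv : ℕ) : ℝ) →
      ∀ {mm : Type} [Fintype mm] [DecidableEq mm] [Nonempty mm] (e : Matrix mm mm ℂ ≃L[ℝ] (ι → ℝ)), (∀ A B : Matrix mm mm ℂ, traceForm A B = e A ⬝ᵥ e B) →
      ∀ (U : Fin (d + 1) → ScX' d L mv kk r hL → (Matrix mm mm ℂ)ˣ), (∀ μ x, (U μ x : Matrix mm mm ℂ) ∈ Matrix.unitaryGroup mm ℂ) →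
      ∀ (ξ C : ℝ), 0 < ξ → 0 ≤ C →
        (∀ k, Reg335Cube (scShift' d L mv kk r hL) U ((((L ^ r * L ^ kk : ℕ) : ℝ))⁻¹) {x : ScX' d L mv kk r hL | blockOf (L ^ r * L ^ kk) (cvM d L mv kk hL) x ∈ cubeBlocks (cvM d L mv kk hL) (coverCorner (cvM d L mv kk hL) (L ^ mv) L (2 * L ^ mv + 1) k) (6 * L ^ mv + 3)} ξ C) →
      ∀ (rV RN θF : ℝ), 0 ≤ rV → 0 ≤ RN → 0 ≤ θF →
        Fintype.card ι * (@basisConst ι _ (Matrix mm mm ℂ) Matrix.frobeniusNormedAddCommGroup Matrix.frobeniusNormedSpace e * (2 * Real.sqrt (Fintype.card mm)) * (Real.sqrt (Fintype.card mm) * ((C / ξ) * Real.exp (((((L ^ r * L ^ kk : ℕ) : ℝ))⁻¹) * (C / ξ))))) ≤ rV →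
        Fintype.card ι * (Fintype.card (Fin (d + 1)) * (Fintype.card ι * (@basisConst ι _ (Matrix mm mm ℂ) Matrix.frobeniusNormedAddCommGroup Matrix.frobeniusNormedSpace e * (2 * Real.sqrt (Fintype.card mm)) * (Real.sqrt (Fintype.card mm) * ((C / ξ) * Real.exp (((((L ^ r * L ^ kk : ℕ) : ℝ))⁻¹) * (C / ξ))))) ^ 2 + @basisConst ι _ (Matrix mm mm ℂ) Matrix.frobeniusNormedAddCommGroup Matrix.frobeniusNormedSpace e * (2 * Real.sqrt (Fintype.card mm)) * (Real.sqrt (Fintype.card mm) * ((C / ξ ^ 2) * Real.exp (((((L ^ r * L ^ kk : ℕ) : ℝ))⁻¹) * (C / ξ)))))) ≤ rV →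
        rV * (1 + Fintype.card (Fin (d + 1) ⊕ Fin (d + 1))) + RN ≤ R₀ → θF ≤ θ₀ →
      ∃ w : (Fin (d + 1) → ZMod (2 * L)) → ScX' d L mv kk r hL → Matrix mm mm ℂ, (∀ k x, (w k x)ᴴ * w k x = 1) ∧
        ∀ (P : (ScX' d L mv kk r hL × ι → ℝ) →ₗ[ℝ] (ScX' d L mv kk r hL × ι → ℝ)) (NV : (Fin (d + 1) → ZMod (2 * L)) → (ScX' d L mv kk r hL × ι → ℝ) →ₗ[ℝ] (ScX' d L mv kk r hL × ι → ℝ)),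
        (∀ k, mmulOp (fun x => coordMat e (ContinuousLinearMap.mulLeftRight ℝ (Matrix mm mm ℂ) (w k x) (w k x)ᴴ)) ∘ₗ P ∘ₗ mmulOp (fun x => (coordMat e (ContinuousLinearMap.mulLeftRight ℝ (Matrix mm mm ℂ) (w k x) (w k x)ᴴ))ᵀ) = (scQQ' d L mv kk r hL (aK a₀ (L : ℝ) (r + kk) * (((L ^ r * L ^ kk : ℕ) : ℝ)) ^ (d + 1)) ι) - NV k) →
        (∀ k, HasMaj (ScNorm' d L mv kk r hL ι) (ScNorm' d L mv kk r hL ι) (mulOp (fun p : ScX' d L mv kk r hL × ι => scPsi' d L mv kk r hL k p.1) ∘ₗ NV k ∘ₗ mulOp (fun p : ScX' d L mv kk r hL × ι => scChi' d L mv kk r hL k p.1)) (fun y y' => RN * Real.exp (-(δ * (unitTorusGeo L kk (cvM d L mv kk hL)).dist y y')))) →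
        (∀ k, HasMaj (ScNorm' d L mv kk r hL ι) (ScNorm' d L mv kk r hL ι) ((LinearMap.id - mulOp (fun p : ScX' d L mv kk r hL × ι => scPsi' d L mv kk r hL k p.1)) ∘ₗ NV k ∘ₗ mulOp (fun p : ScX' d L mv kk r hL × ι => scChi' d L mv kk r hL k p.1)) (fun y y' => θF * Real.exp (-(δ * (unitTorusGeo L kk (cvM d L mv kk hL)).dist y y')))) →
        HasMaj (ScNorm' d L mv kk r hL ι) (ScNorm' d L mv kk r hL ι) (scGlued' d L mv kk r hL (aK a₀ (L : ℝ) (r + kk) * (((L ^ r * L ^ kk : ℕ) : ℝ)) ^ (d + 1)) ((((L ^ r * L ^ kk : ℕ) : ℝ))⁻¹) ι e w (fun μ x => (U μ x : Matrix mm mm ℂ)) P NV)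
          (fun y y' => B * Real.exp (-(δ / 16 * (unitTorusGeo L kk (cvM d L mv kk hL)).dist y y'))) ∧
        (scGlued' d L mv kk r hL (aK a₀ (L : ℝ) (r + kk) * (((L ^ r * L ^ kk : ℕ) : ℝ)) ^ (d + 1)) ((((L ^ r * L ^ kk : ℕ) : ℝ))⁻¹) ι e w (fun μ x => (U μ x : Matrix mm mm ℂ)) P NV ∘ₗ
            (covLapM (scShift' d L mv kk r hL) ((((L ^ r * L ^ kk : ℕ) : ℝ))⁻¹) (gaugePair (scShift' d L mv kk r hL) (fun μ x => coordMat e (ContinuousLinearMap.mulLeftRight ℝ (Matrix mm mm ℂ) (U μ x : Matrix mm mm ℂ) (U μ x : Matrix mm mm ℂ)ᴴ))) + P) = LinearMap.id ∧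
          (covLapM (scShift' d L mv kk r hL) ((((L ^ r * L ^ kk : ℕ) : ℝ))⁻¹) (gaugePair (scShift' d L mv kk r hL) (fun μ x => coordMat e (ContinuousLinearMap.mulLeftRight ℝ (Matrix mm mm ℂ) (U μ x : Matrix mm mm ℂ) (U μ x : Matrix mm mm ℂ)ᴴ))) + P) ∘ₗ
            scGlued' d L mv kk r hL (aK a₀ (L : ℝ) (r + kk) * (((L ^ r * L ^ kk : ℕ) : ℝ)) ^ (d + 1)) ((((L ^ r * L ^ kk : ℕ) : ℝ))⁻¹) ι e w (fun μ x => (U μ x : Matrix mm mm ℂ)) P NV = LinearMap.id) := by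
  obtain ⟨δ, w₀, R₀, θ₀, B, hδ, hR₀, hθ₀, hB, H⟩ := uN_scGlued'_spec_of_reg335Cube (d := d) hL hL7 ha₀ ι
  refine ⟨δ, w₀, R₀, θ₀, B, hδ, hR₀, hθ₀, hB, fun mv kk r hk hr hw₀ => ?_⟩
  intro mm _ _ _ e he U hU ξ C hξ hC h335
  exact H mv kk r hk hr hw₀ e he U hU (fun k => {x : ScX' d L mv kk r hL | blockOf (L ^ r * L ^ kk) (cvM d L mv kk hL) x ∈ cubeBlocks (cvM d L mv kk hL) (coverCorner (cvM d L mv kk hL) (L ^ mv) L (2 * L ^ mv + 1) k) (6 * L ^ mv + 3)}) ξ C hξ hC h335 (fun k x hx => scChi'_ne_zero_nbhd hL hL7 mv kk r k x hx)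

end Reg335

end Summit.QuantumFields.YangMills.BalabanUVNodes.N15.Gluing

end
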